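import Mathlib
import Summits.ResolutionOfSingularities.ResolutionOfSingularities.Theorems.RadicialJungCleanModelsCleanProp44OfTauOneResidual
import Summits.ResolutionOfSingularities.ResolutionOfSingularities.Theorems.RadicialJungCleanModelsCleanSeqOpenTransport
import Summits.ResolutionOfSingularities.ResolutionOfSingularities.Theorems.FrobeniusLadderFInjectiveMacaulayficationProp44CurveStepRT
import Summits.ResolutionOfSingularities.ResolutionOfSingularities.Theorems.FrobeniusLadderFInjectiveMacaulayficationProp44ReachTidy
import Summits.ResolutionOfSingularities.ResolutionOfSingularities.Theorems.MarkedTransferCampaignW46ThreefoldsSigmaCurveStep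
import Literature.AlgebraicGeometry.Resolution.CurveCentreSigmaCoincide
import Literature.AlgebraicGeometry.Resolution.BlowupsExistence
import Literature.AlgebraicGeometry.Resolution.NearPointTauMonotone
import Literature.AlgebraicGeometry.Resolution.NearPointsPointCentre
import Literature.AlgebraicGeometry.Resolution.CurveCentreTwoParameters
import Literature.AlgebraicGeometry.Resolution.BlowupDimension
import Literature.AlgebraicGeometry.Resolution.HironakaTauTransport
import Literature.AlgebraicGeometry.Resolution.BlowupOffCentre
import Literature.AlgebraicGeometry.Resolution.BlowupDisjointCentreSplitting
import Literature.AlgebraicGeometry.Resolution.RegularCentreRsopPart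
import HarnessLib

/-!
# Route `RadicialJung`, crux `CleanModels` (stmt-ResolutionOfSingularities-15917), line `Sketch` rev 35, stub 6 `stub_cleanProp44` (X44c):
# X44c HOLDS IN THE `τ ≥ 2` REGIME — clean Cossart–Piltant 2008 Prop. 4.4 at every stage whose `μ`-stratum has Hironaka `τ ≥ 2`
# at its closed threefold points, UNCONDITIONALLY

Seat decomp-res-hand-2 g15 (structural hand: «reduce to the most general landed lemma, then specialise»).  The most general landed
statement about stub 6 is the clean assembly ✓ `cleanProp44_of_tauOneResidual` (hand-2 g11): X44c follows from three named hypotheses,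
ALL in the `τ = 1` regime of [CoP1] (clean Phase II of reach-tidy at crossings of `Σ`-curves, the clean `τ = 1` isolated-point slice, the
clean curve slice through a `τ = 1` point).  This file proves the complementary SPECIALISATION as ONE theorem in X44c's own currency and
with NO hypothesis left: **if every closed threefold point `x` of the `μ`-stratum `{ord_x J = μ}` of the clean stage `X` has `τ_x ≥ 2`,
then `(J, μ)` becomes order-reducible after a CLEAN-permissible sequence of blowing ups** (`cleanProp44_of_two_le_stalkTau`).  Three
ingredients, each a theorem here:

* `IsCleanPermissibleSeq.two_le_stalkTau_of_forall` — **the `τ ≥ 2` regime is stable under clean-permissible sequences**: along any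
  clean-permissible sequence for `(J, μ)` over a regular quasi-excellent Noetherian threefold, «`τ ≥ 2` at every closed threefold point of
  order `μ`» propagates to every stage (off the centre the local rings do not change, ✓ `IsBlowup.stalkTau_controlledTransform_of_not_mem`;
  over a point centre `τ` does not drop at near points, [CoP1] Lemma 4.3 (3) ✓ `IsBlowup.stalkTau_le_stalkTau_of_isNear_point`, and
  `τ = 3` points have no near point, Lemma 4.3 (1) ✓ `IsBlowup.not_isNear_of_stalkTau_eq_three`; over a curve centre through a `τ ≥ 2`
  point there is no near point at all, Lemma 4.3 (2) ✓ `IsBlowup.not_isNear_of_two_le_stalkTau`).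
* `eq_of_two_le_stalkTau_of_mem_closure` — **at most ONE curve of `Σ` passes through a point with `τ ≥ 2`** ([CoP1] Lemma 4.3 (2),
  second sentence «`Y` and `Σ` coincide locally at `x`», ✓ `IsBlowup.mem_centre_of_idealOrder_eq_of_specializes`, applied to the blowing up
  along the regular curve, which exists by ✓ `exists_isBlowup`): so in the `τ ≥ 2` regime a stage WITHOUT BAD POINTS (clean Phase I,
  ✓ `exists_cleanSeq_regular_transverse`) is already TIDY — Phase II of reach-tidy is empty.
* `cleanProp44_of_two_le_stalkTau` — **X44c in the `τ ≥ 2` regime**: Phase I ✓, the regime persists, the stage is tidy, its pieces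
  (✓ `CP2008Prop44.exists_pieces_of_tidy`) are `τ ≥ 2` threefold points (✓ `exists_isCleanPermissibleSeq_lt_comap_of_isolated_two_le_tau`),
  coheight-`2` points (✓ `exists_isCleanPermissibleSeq_lt_comap_of_isolated_coheight_two`) and regular curves all of whose closed points are
  threefold points with `τ ≥ 2` (✓ `exists_isCleanPermissibleSeq_lt_comap_of_curve_two_le_tau`); a `τ = 1` piece contradicts the regime;
  clean patching ✓ `exists_isCleanPermissibleSeq_lt_of_pieces` and composition ✓ `IsCleanPermissibleSeq.comp`.

So the research content of stub 6 is now LOCALISED by a kernel theorem, not only by a census: X44c is proved outright wherever the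
`μ`-stratum avoids `τ = 1`, and ✓ `cleanProp44_of_tauOneResidual` names what is missing at `τ = 1` (births, memo 4e §2.4–2.6).

Honest framing: OURS; nothing here proves X44c in general, any case of `CleanModels`, or resolution of singularities in characteristic `p`.
[cite: CossartPiltant2008, Prop. 4.4 (proof, pp. 9–11), Lemma 4.3 (1)–(3)] [cite: Piltant2013, Prop. 5.1 (proof, Step 2)]
-/

noncomputable section

set_option linter.dupNamespace false -- mandated namespace of this single-conjunct summit

open CategoryTheory CategoryTheory.Limits AlgebraicGeometry TopologicalSpace IsLocalRing
open Literature.AlgebraicGeometry.Resolution Literature.AlgebraicGeometry.Motives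
open Scheme.IdealSheafData
open Summit.ResolutionOfSingularities.ResolutionOfSingularities.Theorems.CP2008Prop44

namespace Summit.ResolutionOfSingularities.ResolutionOfSingularities.Theorems.RadicialJung.CleanModels

/-! ## §0 Plumbing: coheights and embedding dimensions -/

/-- For a point with regular local ring: embedding dimension `3` iff coheight `3`. [folklore] -/
private theorem spanFinrank_eq_three_iff_coheight {X : Scheme.{0}} (x : X) [IsRegularLocalRing (X.presheaf.stalk x)] :
    (maximalIdeal (X.presheaf.stalk x)).spanFinrank = 3 ↔ Order.coheight x = 3 := by
  have h := CampaignW46.coheight_eq_spanFinrank x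
  constructor
  · intro hd
    rw [h, hd]
    rfl
  · intro hc
    rw [hc] at h
    exact_mod_cast h.symm

/-- Two points of coheight `2` one of which specialises to the other are equal. [folklore] -/
private theorem eq_of_specializes_of_coheight_eq_two {X : Scheme.{0}} {ζ₁ ζ₂ : X} (h : ζ₁ ⤳ ζ₂)
    (h₁ : Order.coheight ζ₁ = 2) (h₂ : Order.coheight ζ₂ = 2) : ζ₁ = ζ₂ := by
  by_contra hne
  have hlt : ζ₂ < ζ₁ := ⟨h, fun h' => hne (h.antisymm h').eq⟩
  have h3 := Order.coheight_add_one_le hlt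
  rw [h₁, h₂] at h3
  exact absurd h3 (by decide)

/-! ## §1 The `τ ≥ 2` regime is stable under clean-permissible sequences -/

set_option maxHeartbeats 800000 in
-- near-point bookkeeping at each step of the induction
/-- **The `τ ≥ 2` regime propagates along clean-permissible sequences.**  Let `X` be integral Noetherian regular quasi-excellent of
dimension `≤ 3`, `(J, μ)` with `μ ≥ 1`, `ord ≤ μ`, `V(J)` of codimension `≥ 2`, and suppose every CLOSED point `x` with `ord_x J = μ` and
embedding dimension `3` has Hironaka `τ_x ≥ 2`.  Then along any clean-permissible sequence `π : X' → X` for `(J, μ)` with transform `J'`,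
every closed point `x'` of `X'` with `ord_{x'} J' = μ` and embedding dimension `3` has `τ_{x'} ≥ 2`.
[cite: CossartPiltant2008, Lemma 4.3 (1) (2) (3)] -/
theorem IsCleanPermissibleSeq.two_le_stalkTau_of_forall {p : ℕ} {X' X : Scheme.{0}} [IsIntegral X'] [IsIntegral X]
    {π : X' ⟶ X} [IsDominant π] {J : X.IdealSheafData} {μ : ℕ} {J' : X'.IdealSheafData} {G : X.functionField}
    (h : IsCleanPermissibleSeq p π J μ J' G) :
    IsNoetherian X → Scheme.IsRegular X → Scheme.IsQuasiExcellent X → topologicalKrullDim X ≤ 3 → 1 ≤ μ →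
      (∀ x, idealOrder J x ≤ μ) → (∀ x ∈ J.support, 1 < Order.coheight x) →
      (∀ x : X, IsClosed ({x} : Set X) → idealOrder J x = μ → (maximalIdeal (X.presheaf.stalk x)).spanFinrank = 3 →
        ∀ hr : IsRegularLocalRing (X.presheaf.stalk x), 2 ≤ @stalkTau X J x hr μ) →
      ∀ x' : X', IsClosed ({x'} : Set X') → idealOrder J' x' = μ → (maximalIdeal (X'.presheaf.stalk x')).spanFinrank = 3 →
        ∀ hr : IsRegularLocalRing (X'.presheaf.stalk x'), 2 ≤ @stalkTau X' J' x' hr μ := by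
  induction h with
  | nil J μ G => intro _ _ _ _ _ _ _ hτ2; exact hτ2
  | @cons X'' X' X _ _ _ τ _ π _ J μ J' G Y hπ hint hreg hY hτ hperm ih =>
    intro hN hX hqe hX3 hμ hle hcodim hτ2 x'' hx''cl hord'' hd'' hr''
    haveI := hN
    have IH := ih hN hX hqe hX3 hμ hle hcodim hτ2
    -- the invariants at the intermediate stage `X'`
    obtain ⟨-, hnoeth', hX', -, -, hcodim'⟩ :=
      IsPermissibleBlowupSeq.prop44Invariants hX hqe hμ hle hcodim (isPermissibleBlowupSeq_of_isPermissibleSeq hπ.isPermissibleSeq)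
    haveI := hnoeth'
    have hX3' : topologicalKrullDim X' ≤ 3 :=
      (isPermissibleBlowupSeq_of_isPermissibleSeq hπ.isPermissibleSeq).topologicalKrullDim_le inferInstance hX3
    have hcoh3' : ∀ z : X', Order.coheight z ≤ 3 := (topologicalKrullDim_le_iff_forall_coheight_le X' 3).mp hX3'
    haveI : IsProper τ := hτ.isProper
    haveI : IsLocallyNoetherian X'' := hτ.isLocallyNoetherian
    haveI hry : IsRegularLocalRing (X'.presheaf.stalk (τ x'')) := hX' (τ x'')
    -- the image point is closed, of embedding dimension `3`
    have hycl : IsClosed ({τ x''} : Set X') := by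
      have := τ.isClosedMap _ hx''cl
      rwa [Set.image_singleton] at this
    have hcohx'' : Order.coheight x'' = 3 := (spanFinrank_eq_three_iff_coheight x'').mp hd''
    have hcohy : Order.coheight (τ x'') = 3 :=
      le_antisymm (hcoh3' _) (hcohx'' ▸ hτ.coheight_le x'')
    have hdy : (maximalIdeal (X'.presheaf.stalk (τ x''))).spanFinrank = 3 := (spanFinrank_eq_three_iff_coheight _).mpr hcohy
    by_cases hmem : τ x'' ∈ (Y : Set X')
    · -- over the centre: `x''` is a near point of the closed threefold point `τ x''` of the stratum, where `τ ≥ 2`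
      have hnear : IsNear τ (vanishingIdeal Y) J' μ x'' := isNear_iff.mpr hord''
      have hordy : idealOrder J' (τ x'') = μ := hY _ hmem
      have hτy : 2 ≤ stalkTau J' (τ x'') μ := IH (τ x'') hycl hordy hdy hry
      -- the generic point of the (irreducible) centre
      have hirr : IsIrreducible (Y : Set X') := isIrreducible_of_isIntegral_subscheme_vanishingIdeal Y hint
      obtain ⟨η, hη⟩ := QuasiSober.sober hirr Y.isClosed
      have hYeq : (Y : Set X') = closure {η} := (isGenericPoint_def.mp hη).symm
      have hηY : η ∈ (Y : Set X') := hη.mem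
      by_cases hηy : η = τ x''
      · -- POINT centre `Y = {τ x''}`: `τ(τ x'') ≤ 2` (Lemma 4.3 (1)), hence `= 2`, and `τ` does not drop (Lemma 4.3 (3))
        have hYpt : (Y : Set X') = {τ x''} := by rw [hYeq, hηy, hycl.closure_eq]
        have hYc : Y = ⟨{τ x''}, hycl⟩ := Closeds.ext hYpt
        obtain ⟨c3, hc3, hc3Y⟩ := CampaignW46.exists_rsop_three hycl hdy
        rw [← hYc] at hc3Y
        have hτy2 : stalkTau J' (τ x'') μ ≤ 2 := hτ.stalkTau_le_two_of_isNear_point hdy hc3 hc3Y hnear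
        have hτyeq : stalkTau J' (τ x'') μ = 2 := le_antisymm hτy2 hτy
        have hmono := hτ.stalkTau_le_stalkTau_of_isNear_point hμ hdy hc3 hc3Y hτyeq hnear
        rw [hτyeq] at hmono
        exact hmono
      · -- CURVE centre through the `τ ≥ 2` point `τ x''`: no near point (Lemma 4.3 (2)) — contradiction
        exfalso
        have hηy' : η ⤳ τ x'' := specializes_iff_mem_closure.mpr (hYeq ▸ hmem)
        have hyη : ¬ τ x'' ⤳ η := fun h' => hηy (hηy'.antisymm h').eq
        have hηsupp : η ∈ J'.support := by
          rw [← one_le_idealOrder_iff, hY η hηY]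
          exact_mod_cast hμ
        have h1 : 1 < Order.coheight η := hcodim' η hηsupp
        obtain ⟨c, hcr, hcY⟩ := exists_isRsopPart_fin_two_of_specializes hreg hYeq hηy' hyη h1 (hcoh3' _)
        exact hτ.not_isNear_of_two_le_stalkTau hX' hreg hμ hY hcr hcY hτy hnear
    · -- off the centre: the local ring, the order and `τ` do not change
      have hnot : τ x'' ∉ ((vanishingIdeal Y).support : Set X') := by
        rwa [Scheme.IdealSheafData.coe_support_vanishingIdeal]
      have hτeq := hτ.stalkTau_controlledTransform_of_not_mem J' μ μ hnot (x' := x'')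
      have hordeq := hτ.idealOrder_controlledTransform_of_not_mem J' μ hnot
      rw [hordeq] at hord''
      rw [hτeq]
      exact IH (τ x'') hycl hord'' hdy hry

/-! ## §2 At most one curve of `Σ` through a point with `τ ≥ 2` -/

/-- **At most ONE curve of `Σ = {ord ≥ μ}` passes through a point with `τ ≥ 2`.**  `X` integral Noetherian regular quasi-excellent,
`(J, μ)` with `μ ≥ 1`, `ord ≤ μ`, `V(J)` of codimension `≥ 2`; `ζ₁, ζ₂` points of `Σ` of coheight `2` (generic points of curves of `Σ`),
the curve `cl{ζ₁}` regular and cut out at a point `x ∈ cl{ζ₂}` by two members of a regular system of parameters, and `τ_x ≥ 2`: then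
`ζ₁ = ζ₂`.  Indeed by [CoP1] Lemma 4.3 (2) («`Y` and `Σ` coincide locally at `x`», ✓ `IsBlowup.mem_centre_of_idealOrder_eq_of_specializes`
for the blowing up along `cl{ζ₁}`, which exists ✓ `exists_isBlowup`) the point `ζ₂ ∈ Σ` specialising to `x` lies on `cl{ζ₁}`, and two points
of the same coheight one of which specialises to the other coincide. [cite: CossartPiltant2008, Lemma 4.3 (2)] -/
theorem eq_of_two_le_stalkTau_of_mem_closure {X : Scheme.{0}} [IsIntegral X] [IsNoetherian X] (hX : Scheme.IsRegular X)
    (hqe : Scheme.IsQuasiExcellent X) (J : X.IdealSheafData) {μ : ℕ} (hμ : 1 ≤ μ)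
    (hle : ∀ z, idealOrder J z ≤ μ) (hcodim : ∀ z ∈ J.support, 1 < Order.coheight z)
    {ζ₁ ζ₂ : X} (hζ₁ : (μ : ℕ∞) ≤ idealOrder J ζ₁) (hcoh₁ : Order.coheight ζ₁ = 2)
    (hζ₂ : (μ : ℕ∞) ≤ idealOrder J ζ₂) (hcoh₂ : Order.coheight ζ₂ = 2)
    (hreg : Scheme.IsRegular (vanishingIdeal (⟨closure {ζ₁}, isClosed_closure⟩ : Closeds X)).subscheme)
    {x : X} (hx₂ : x ∈ closure ({ζ₂} : Set X))
    [IsRegularLocalRing (X.presheaf.stalk x)]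
    {c : Fin 2 → X.presheaf.stalk x} (hcr : IsRsopPart c)
    (hcY : Ideal.span (Set.range c) = stalkIdeal (vanishingIdeal (⟨closure {ζ₁}, isClosed_closure⟩ : Closeds X)) x)
    (hτ : 2 ≤ stalkTau J x μ) : ζ₁ = ζ₂ := by
  set C : Closeds X := ⟨closure {ζ₁}, isClosed_closure⟩ with hCdef
  -- `C ⊆ {ord = μ}`
  have hCord : ∀ y ∈ (C : Set X), idealOrder J y = μ := by
    intro y hy
    haveI := hX y
    exact le_antisymm (hle y) (hζ₁.trans (idealOrder_le_of_specializes (specializes_iff_mem_closure.mpr hy) J))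
  -- the blowing up along the regular curve `C`
  obtain ⟨X', π, hπ⟩ := exists_isBlowup X (vanishingIdeal C)
  have hJne : J ≠ ⊥ := ne_bot_of_forall_one_lt_coheight hcodim
  have hJ2 : ∀ U : X.affineOpens, IsJ2Ring Γ(X, U) := fun U => (hqe U).isJ2Ring
  have hord₂ : idealOrder J ζ₂ = μ := le_antisymm (hle _) hζ₂
  have hζ₂x : ζ₂ ⤳ x := specializes_iff_mem_closure.mpr hx₂
  -- Lemma 4.3 (2), second sentence: `ζ₂ ∈ C`
  have hmem : ζ₂ ∈ (C : Set X) :=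
    hπ.mem_centre_of_idealOrder_eq_of_specializes hX hJ2 hreg hJne hμ hCord hle hcr hcY hτ hord₂ hζ₂x
  exact eq_of_specializes_of_coheight_eq_two (specializes_iff_mem_closure.mpr hmem) hcoh₁ hcoh₂

/-! ## §3 X44c in the `τ ≥ 2` regime -/

/-- In the situation of `exists_isCleanPermissibleSeq_lt_of_pieces`: a point of order `≥ m` lies in `Z i` or outside `V i`. [folklore] -/
private theorem mem_or_not_mem_of_cover' {X : Scheme.{0}} {J : X.IdealSheafData} {m : ℕ} {n : ℕ} {Z : Fin n → Set X}
    (hcov : ∀ z : X, (m : ℕ∞) ≤ idealOrder J z → ∃ i, z ∈ Z i) (i : Fin n) (V : X.Opens)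
    (hV : (V : Set X) = (⋃ j ∈ {j : Fin n | j ≠ i}, Z j)ᶜ) (z : X) (hz : (m : ℕ∞) ≤ idealOrder J z) :
    z ∈ Z i ∨ z ∉ (V : Set X) := by
  obtain ⟨j, hj⟩ := hcov z hz
  by_cases hji : j = i
  · exact Or.inl (hji ▸ hj)
  · right
    rw [hV, Set.mem_compl_iff, not_not]
    exact Set.mem_iUnion₂.mpr ⟨j, hji, hj⟩

/-- A piece contained in `V i`. [folklore] -/
private theorem subset_of_cover' {X : Scheme.{0}} {n : ℕ} {Z : Fin n → Set X} (hdisj : ∀ i j, i ≠ j → Disjoint (Z i) (Z j))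
    (i : Fin n) (V : X.Opens) (hV : (V : Set X) = (⋃ j ∈ {j : Fin n | j ≠ i}, Z j)ᶜ) : Z i ⊆ (V : Set X) := by
  intro z hz
  rw [hV, Set.mem_compl_iff, Set.mem_iUnion₂]
  rintro ⟨j, hj, hzj⟩
  exact Set.disjoint_left.mp (hdisj i j (Ne.symm hj)) hz hzj

set_option maxHeartbeats 1600000 in
-- the binder list of X44c is long (as in the tree's `cossartPiltant2008_prop44_holds`) and the piece analysis has five branches
/-- **X44c (`stub_cleanProp44`) IN THE `τ ≥ 2` REGIME, UNCONDITIONALLY.**  The binders of `stub_cleanProp44` VERBATIM, plus ONE hypothesis: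
every closed point `x` of the stage `X` with `ord_x J = μ` and embedding dimension `3` has Hironaka `τ_x(J, μ) ≥ 2`.  Conclusion: the
conclusion of `stub_cleanProp44` verbatim — a CLEAN-permissible sequence `π : X' → X` for `(J, μ)` and the line of `ρ^♯ G₀` after which
`ord J' < μ` everywhere.  See the module docstring for the proof. [cite: CossartPiltant2008, Prop. 4.4 (proof, pp. 9–11), Lemma 4.3]
[cite: Piltant2013, Prop. 5.1 (proof, Step 2)] -/
theorem cleanProp44_of_two_le_stalkTau :
    ∀ (p : ℕ), p.Prime → ∀ (S : Scheme.{0}) [IsIntegral S] [IsNoetherian S],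
      CharP S.functionField p → Scheme.IsRegular S → Scheme.IsExcellent S → topologicalKrullDim S = 3 →
      ∀ G₀ : S.functionField, (∀ s : S, CleanRegAt p (algebraMap (S.presheaf.stalk s) S.functionField) G₀) →
      ∀ I : S.IdealSheafData, I ≠ ⊥ →
      ∀ (X : Scheme.{0}) (ρ : X ⟶ S) [IsIntegral X] [IsNoetherian X] [IsDominant ρ],
        IsCleanRegularCentreBlowupSeq p ρ I G₀ →
        (∀ x : X, CleanRegAt p (algebraMap (X.presheaf.stalk x) X.functionField) (RatFn.functionFieldMap ρ G₀)) →
        ∀ (J : X.IdealSheafData) (μ : ℕ), 1 ≤ μ →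
          (∀ x ∈ J.support, 1 < Order.coheight x) → (∀ x, idealOrder J x ≤ μ) → (∃ x, idealOrder J x = μ) →
          (∀ x : X, IsClosed ({x} : Set X) → idealOrder J x = μ → (maximalIdeal (X.presheaf.stalk x)).spanFinrank = 3 →
            ∀ hr : IsRegularLocalRing (X.presheaf.stalk x), 2 ≤ @stalkTau X J x hr μ) →
          ∃ (X' : Scheme.{0}) (π : X' ⟶ X) (_ : IsIntegral X') (_ : IsDominant π) (J' : X'.IdealSheafData),
            IsCleanPermissibleSeq p π J μ J' (RatFn.functionFieldMap ρ G₀) ∧ ∀ x, idealOrder J' x < μ := by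
  intro p hp S _ _ hchar hS hexc hdimS G₀ _ I _ X ρ _ _ _ hρ hG J μ hμ hcodim hle _ hτ2
  have hρ' : IsRegularCentreBlowupSeq ρ I := hρ.isRegularCentreBlowupSeq
  have hX : Scheme.IsRegular X := hρ'.isRegular hS
  have hqe : Scheme.IsQuasiExcellent X := hρ'.isQuasiExcellent hexc
  have hX3 : topologicalKrullDim X ≤ 3 := CP2008Prop44.topologicalKrullDim_stage_le hρ' inferInstance (n := 3) hdimS.le
  haveI hcharX : CharP X.functionField p := charP_of_injective_ringHom (RatFn.functionFieldMap ρ).injective p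
  set G : X.functionField := RatFn.functionFieldMap ρ G₀ with hGdef
  -- Phase I (clean, ✓): a stage without bad points
  obtain ⟨X₁, Φ, hint₁', hΦ, J₁, hseq, hRT⟩ := exists_cleanSeq_regular_transverse hp hX hqe hX3 G hG J hμ hle hcodim
  haveI := hint₁'
  haveI := hΦ
  -- the invariants at the reached stage (over the forgetful map to the W4.6 currency)
  have hseqW : CampaignW46.IsPermissibleBlowupSeq J μ Φ J₁ :=
    CP2008Prop44.isPermissibleBlowupSeq_of_isPermissibleSeq hseq.isPermissibleSeq
  obtain ⟨-, hnoeth₁, hX₁, hqe₁, hle₁, hcodim₁, hG₁⟩ :=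
    CP2008Prop44.prop44Invariants_stage S hS hexc I X ρ hρ' J μ hμ hcodim hle hseqW
  have hX3₁ : topologicalKrullDim X₁ ≤ 3 := CP2008Prop44.prop44Invariants_stage_dim hρ' (n := 3) hdimS.le hseqW
  haveI := hnoeth₁
  haveI hcharX₁ : CharP X₁.functionField p := charP_of_injective_ringHom (RatFn.functionFieldMap Φ).injective p
  have hcoh3 : ∀ z : X₁, Order.coheight z ≤ 3 := (topologicalKrullDim_le_iff_forall_coheight_le X₁ 3).mp hX3₁
  -- the line stays clean-regular at every point of the reached stage
  have hG₁' : ∀ x : X₁, CleanRegAt p (algebraMap (X₁.presheaf.stalk x) X₁.functionField) (RatFn.functionFieldMap Φ G) :=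
    hseq.cleanRegAt hp hcharX hG
  -- THE REGIME PERSISTS at the reached stage
  have hτ2₁ : ∀ x : X₁, IsClosed ({x} : Set X₁) → idealOrder J₁ x = μ → (maximalIdeal (X₁.presheaf.stalk x)).spanFinrank = 3 →
      ∀ hr : IsRegularLocalRing (X₁.presheaf.stalk x), 2 ≤ @stalkTau X₁ J₁ x hr μ :=
    hseq.two_le_stalkTau_of_forall inferInstance hX hqe hX3 hμ hle hcodim hτ2
  -- the stage is TIDY: the curves of `Σ` are regular (no bad point) …
  have htidy_reg : ∀ ζ : X₁, (μ : ℕ∞) ≤ idealOrder J₁ ζ → Order.coheight ζ = 2 → ¬ IsClosed ({ζ} : Set X₁) →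
      Scheme.IsRegular (vanishingIdeal (⟨closure {ζ}, isClosed_closure⟩ : Closeds X₁)).subscheme :=
    fun ζ hζ hcoh hcl => (curve_of_noBad hX₁ hX3₁ J₁ hμ hle₁ hcodim₁ (𝒞 := {C : Closeds X₁ | _}) (fun C => Iff.rfl) hRT
      ⟨ζ, mem_maxPoints_setOf_of_coheight_eq_two hμ hcoh3 hcodim₁ hζ hcoh, hcl, rfl⟩).1
  -- … and pairwise DISJOINT: at most one curve of `Σ` through a `τ ≥ 2` point
  have htidy_disj : ∀ ζ₁ ζ₂ : X₁, (μ : ℕ∞) ≤ idealOrder J₁ ζ₁ → Order.coheight ζ₁ = 2 → ¬ IsClosed ({ζ₁} : Set X₁) →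
      (μ : ℕ∞) ≤ idealOrder J₁ ζ₂ → Order.coheight ζ₂ = 2 → ¬ IsClosed ({ζ₂} : Set X₁) → ζ₁ ≠ ζ₂ →
      Disjoint (closure ({ζ₁} : Set X₁)) (closure {ζ₂}) := by
    intro ζ₁ ζ₂ hζ₁ hc₁ hn₁ hζ₂ hc₂ hn₂ hne
    rw [Set.disjoint_iff]
    rintro q ⟨hq₁, hq₂⟩
    have hmax₁ := mem_maxPoints_setOf_of_coheight_eq_two hμ hcoh3 hcodim₁ hζ₁ hc₁
    have hmax₂ := mem_maxPoints_setOf_of_coheight_eq_two hμ hcoh3 hcodim₁ hζ₂ hc₂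
    obtain ⟨hCreg, -, hCord, hCcurve, hCtr⟩ := curve_of_noBad hX₁ hX3₁ J₁ hμ hle₁ hcodim₁ (𝒞 := {C : Closeds X₁ | _})
      (fun C => Iff.rfl) hRT ⟨ζ₁, hmax₁, hn₁, rfl⟩
    -- the two curves are distinct members of the family of curves of `Σ`
    have hDC : (⟨closure {ζ₂}, isClosed_closure⟩ : Closeds X₁) ≠ ⟨closure {ζ₁}, isClosed_closure⟩ := by
      intro h
      have h' : closure ({ζ₂} : Set X₁) = closure {ζ₁} := congrArg (fun D : Closeds X₁ => (D : Set X₁)) h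
      have h12 : ζ₁ ⤳ ζ₂ := specializes_iff_mem_closure.mpr (h' ▸ subset_closure rfl)
      exact hne (eq_of_specializes_of_coheight_eq_two h12 hc₁ hc₂)
    obtain ⟨-, hdim3⟩ := hCtr _ ⟨ζ₂, hmax₂, hn₂, rfl⟩ hDC q ⟨hq₁, hq₂⟩
    -- `q` is a closed threefold point of the stratum, so `τ_q ≥ 2`
    haveI hrq : IsRegularLocalRing (X₁.presheaf.stalk q) := hX₁ q
    have hdq : (maximalIdeal (X₁.presheaf.stalk q)).spanFinrank = 3 := by
      have h1 := IsRegularLocalRing.spanFinrank_maximalIdeal (R := X₁.presheaf.stalk q)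
      rw [hdim3] at h1
      exact_mod_cast h1
    have hcohq : Order.coheight q = 3 := (spanFinrank_eq_three_iff_coheight q).mp hdq
    have hqcl : IsClosed ({q} : Set X₁) := isClosed_singleton_of_coheight_eq_three hcoh3 hcohq
    have hτq : 2 ≤ stalkTau J₁ q μ := hτ2₁ q hqcl (hCord q hq₁) hdq hrq
    obtain ⟨c, hcr, hcY⟩ := hCcurve q hq₁ hrq
    exact hne (eq_of_two_le_stalkTau_of_mem_closure hX₁ hqe₁ J₁ hμ hle₁ hcodim₁ hζ₁ hc₁ hζ₂ hc₂ hCreg hq₂ hcr hcY hτq)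
  -- the pieces of the tidy stage (✓)
  obtain ⟨n, Z, hZc, hdisj, hcov, hkind⟩ := exists_pieces_of_tidy hX₁ hqe₁ hX3₁ J₁ hμ hle₁ hcodim₁ htidy_reg htidy_disj
  -- settle each piece relative to the complement of the others, and patch
  have hred : ∃ (X' : Scheme.{0}) (π : X' ⟶ X₁) (_ : IsIntegral X') (_ : IsDominant π) (J' : X'.IdealSheafData),
      IsCleanPermissibleSeq p π J₁ μ J' (RatFn.functionFieldMap Φ G) ∧ ∀ x, idealOrder J' x < μ := by
    refine exists_isCleanPermissibleSeq_lt_of_pieces J₁ μ (RatFn.functionFieldMap Φ G) Z hZc hdisj hcov fun i V hV => ?_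
    intro hVint hVdom
    have hbad := mem_or_not_mem_of_cover' hcov i V hV
    have hZV := subset_of_cover' hdisj i V hV
    rcases hkind i with ⟨x, hZ, hord, hdim, hτ⟩ | ⟨x, hZ, hord, hdim, hτ⟩ | ⟨x, hZ, hord, hcoh⟩ | ⟨Y, hZ, hreg, hirr, hordY, hcurveY⟩
    · -- τ ≥ 2 threefold point: the CLEAN isolated τ ≥ 2 slice (✓ `…CleanTauTwoSlice`)
      have hxV : x ∈ V := hZV (by rw [hZ]; exact Set.mem_singleton x)
      have hcl : IsClosed ({x} : Set X₁) := hZ ▸ hZc i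
      exact exists_isCleanPermissibleSeq_lt_comap_of_isolated_two_le_tau hp hX₁ J₁ hμ (RatFn.functionFieldMap Φ G) hG₁' V x hxV hcl
        (fun z hz => (hbad z hz).imp (fun h => by rw [hZ] at h; exact h) id) hord hdim (hτ (hX₁ x)) (hG₁ x)
    · -- τ = 1 threefold point: EXCLUDED by the regime
      exfalso
      have hcl : IsClosed ({x} : Set X₁) := hZ ▸ hZc i
      have h2 := hτ2₁ x hcl hord hdim (hX₁ x)
      have h1 := hτ (hX₁ x)
      omega
    · -- coheight-2 point: the CLEAN local-dimension-two slice (✓ `…CleanDimTwoSlice`)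
      have hxV : x ∈ V := hZV (by rw [hZ]; exact Set.mem_singleton x)
      have hcl : IsClosed ({x} : Set X₁) := hZ ▸ hZc i
      exact exists_isCleanPermissibleSeq_lt_comap_of_isolated_coheight_two hp hX₁ J₁ hμ hle₁ hcodim₁ (RatFn.functionFieldMap Φ G) hG₁'
        V x hxV hcl (fun z hz => (hbad z hz).imp (fun h => by rw [hZ] at h; exact h) id) hord hcoh
    · -- regular irreducible piece `Y` of the stratum: its generic point `η`
      obtain ⟨η, hη⟩ := QuasiSober.sober hirr Y.isClosed
      have hYeq : (Y : Set X₁) = closure {η} := (isGenericPoint_def.mp hη).symm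
      have hηY : η ∈ (Y : Set X₁) := hη.mem
      have hordη : idealOrder J₁ η = μ := hordY η hηY
      have hηsupp : η ∈ J₁.support := by
        rw [← one_le_idealOrder_iff, hordη]
        exact_mod_cast hμ
      have h1η : 1 < Order.coheight η := hcodim₁ η hηsupp
      by_cases hηcl : IsClosed ({η} : Set X₁)
      · -- degenerate piece `Y = {η}`: a single closed point
        have hYpt : (Y : Set X₁) = {η} := by rw [hYeq, hηcl.closure_eq]
        have hηV : η ∈ V := hZV (by rw [hZ]; exact hηY)
        have hbad' : ∀ z : X₁, (μ : ℕ∞) ≤ idealOrder J₁ z → z = η ∨ z ∉ (V : Set X₁) :=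
          fun z hz => (hbad z hz).imp (fun h => by rw [hZ, hYpt] at h; exact h) id
        by_cases hcohη : Order.coheight η = 3
        · -- a threefold point, `τ ≥ 2` by the regime: the clean isolated τ ≥ 2 slice
          haveI hrη : IsRegularLocalRing (X₁.presheaf.stalk η) := hX₁ η
          have hdη : (maximalIdeal (X₁.presheaf.stalk η)).spanFinrank = 3 := (spanFinrank_eq_three_iff_coheight η).mpr hcohη
          exact exists_isCleanPermissibleSeq_lt_comap_of_isolated_two_le_tau hp hX₁ J₁ hμ (RatFn.functionFieldMap Φ G) hG₁' V η hηV
            hηcl hbad' hordη hdη (hτ2₁ η hηcl hordη hdη (hX₁ η)) (hG₁ η)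
        · -- a coheight-2 point: the clean local-dimension-two slice
          have hcoh2 : Order.coheight η = 2 := by
            have h3 := hcoh3 η
            generalize hc : Order.coheight η = c at h1η h3 hcohη
            induction c using ENat.recTopCoe with
            | top => exact absurd h3 (by simp)
            | coe m =>
              have h1' : 1 < m := by exact_mod_cast h1η
              have h3' : m ≤ 3 := by exact_mod_cast h3
              have hne3 : m ≠ 3 := fun h => hcohη (by rw [h]; rfl)
              have : m = 2 := by omega
              rw [this]
              rfl
          exact exists_isCleanPermissibleSeq_lt_comap_of_isolated_coheight_two hp hX₁ J₁ hμ hle₁ hcodim₁ (RatFn.functionFieldMap Φ G)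
            hG₁' V η hηV hηcl hbad' hordη hcoh2
      · -- a genuine curve: its closed points are threefold points of the stratum, `τ ≥ 2` there by the regime: the clean τ ≥ 2 curve slice
        have hall : ∀ y ∈ (Y : Set X₁), IsClosed ({y} : Set X₁) → haveI := hX₁ y; 2 ≤ stalkTau J₁ y μ := by
          intro y hy hycl
          have hηy : η ⤳ y := specializes_iff_mem_closure.mpr (hYeq ▸ hy)
          have hyη : ¬ y ⤳ η := fun h' => hηcl (by rw [(hηy.antisymm h').eq]; exact hycl)
          obtain ⟨-, hcohy⟩ := coheight_eq_two_of_specializes hηy hyη h1η (hcoh3 y)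
          haveI hry : IsRegularLocalRing (X₁.presheaf.stalk y) := hX₁ y
          have hdy : (maximalIdeal (X₁.presheaf.stalk y)).spanFinrank = 3 := (spanFinrank_eq_three_iff_coheight y).mpr hcohy
          exact hτ2₁ y hycl (hordY y hy) hdy (hX₁ y)
        exact exists_isCleanPermissibleSeq_lt_comap_of_curve_two_le_tau hp hX₁ hqe₁ hX3₁ (RatFn.functionFieldMap Φ G) hG₁' J₁ hμ hle₁ V Y hirr
          (hZ ▸ hZV) (fun z hz => (hbad z hz).imp (fun h => by rw [hZ] at h; exact h) id) hordY (fun y hy => hcurveY y hy (hX₁ y)) hall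
  -- compose with the Phase I sequence
  obtain ⟨X', π, hX', hπ, J', hseq', hlt⟩ := hred
  haveI := hX'
  haveI := hπ
  exact ⟨X', π ≫ Φ, inferInstance, inferInstance, J', hseq.comp hseq' rfl, hlt⟩

end Summit.ResolutionOfSingularities.ResolutionOfSingularities.Theorems.RadicialJung.CleanModels

end
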